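import Summits.QuantumFields.BalabanUV.Beta.GAN24.DirichletExhaustion
import Summits.QuantumFields.BalabanUV.Beta.GAN24.DirichletExhaustionFamily
import Literature.MathematicalPhysics.QuantumFieldTheory.Balaban1983to89.Beta.ExpKernelCalculus

/-!
# `BalabanUV.Beta.GAN24.DirichletExhaustionDecays` — binder row G-an2-4 / (CONV-C), part P2, PART 4: the CURRENCY BRIDGE from
# B4's index set (`ℤ^d × Fin N`, sup-distance; PARTS 1–3) to the β-lane's matrix-fibred kernels `ExpKernelCalculus.MKer d (Fin N)`
# (ℓ¹ distance; an2 / asym1: `HessKerRate` §4 consumes `Decays (A j − A∞) (c_A θ^j) δ`) (unit b2b-balaban-gan24-p2, gen 1, v1)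

HONEST FRAMING (cell contract, verbatim): «discharging `BetaPertH` makes Bałaban's UV stability UNCONDITIONAL — a real
constructive-QFT result; it is NOT the continuum limit and NOT the Clay problem.»  Bookkeeping only: currying
`K d N → K d N → ℝ` into `MKer d (Fin N)` and the comparison `|x − y|₁ ≤ d·|x − y|_∞` (so an `e^{−δ|·|_∞}` bound is an
`e^{−(δ/d)|·|₁}` bound).  With it, PART 1's target shape `ConvC C C₄ δ₄ θ` delivers, in the β-lane's `Decays` currency, the
UNIFORM clause `Decays (𝔎 k) C₄ (δ₄/d)` (= the binder `hA` of `HessKerRate.geometricRate_hessKer` /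
`geomRate_secondMoment_hessKer`) and the STEP clause `Decays (𝔎 (k+1) − 𝔎 k) (C₄θ^k) (δ₄/d)` (= the consecutive-level input
`hAA : Decays (A − A′) εA δ` of `HessKerRate.decay510_hessKer_sub`); under PART 1's `OpFamilyRate` both hold for every Dirichlet
inverse family `k ↦ limInv Λ (A k)` (§3), and — v1.1, §4 — so do the two LIMIT clauses of `geometricRate_hessKer`, `hAinf :
Decays A∞ C δ` and `hArate : ∀ j, Decays (A j − A∞) (c_A θ^j) δ`, with `A∞ := limInv Λ (opLim A)` = the Dirichlet inverse of
the limit operator (PART 2's `dirichletExhaustion_rate` / `limInv_opLim_abs_le` BY NAME; `c_A = rateConst·θ₀/(1−θ)`).  [folklore];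
formalises no printed statement; instantiates nothing of Bałaban's; NOT `BetaPertH`, NOT continuum, NOT Clay.

v1.1 (gen 10; every v1 declaration byte-identical to p197236; one import added (PART 2 `DirichletExhaustionFamily`), §4
appended): XREAD C-gan24leaf08-g9 (leaf-08-g9) DOCFIX D1 — v1's header said the file «delivers EXACTLY the two hypotheses of
`geometricRate_hessKer` / `geomRate_secondMoment_hessKer`», which overstated by one telescoping: those theorems take the distance
to a LIMIT kernel (`hArate`), v1 supplied the consecutive-level step.  Rather than only re-word, §4 now supplies the limit form.
v1.2 (gen 10, docstring-only): the import census of the «What this file proves» heading below now lists PART 2 as well.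

ABSOLUTE RULE (cell, verbatim): «No internally-minted statement may enter as a cited fact. Every hypothesis is either
kernel-proved in this package or a verbatim quotation of a PUBLISHED theorem with page reference. The manuscript(s) under
audit are NOT citable for their own disputed steps — they are the thing under adjudication; programme-internal
(2001/route/tribunal) claims are never citable.»

## What this file proves (0 sorry; imports PART 1, PART 2 `DirichletExhaustionFamily` (since v1.1, for §4) + the lead's `Beta.ExpKernelCalculus`)
`toMKer` (currying), `l1_sub_le_mul_dist` (`|x−y|₁ ≤ d·dist x y`), `exp_sup_le_exp_l1`, **`decays_toMKer_of_bound`**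
(a sup-distance entry bound ⟹ `Decays` at rate `δ/d`), **`decays_of_convC`** / **`decays_sub_of_convC`** (the two (CONV-C)
clauses in `Decays` currency), **`decays_limInv_sub`** (under `OpFamilyRate`: `Decays (toMKer (limInv Λ (A (k+1))) −
toMKer (limInv Λ (A k))) (rateConst·θ₀·θ^k) (δ⋆/d)`) and `decays_limInv` (uniform: `cStar`, `δ⋆/d`); §4 (v1.1)
**`decays_limInv_opLim`** (`Decays (toMKer (limInv Λ (opLim A))) c⋆ (δ⋆/d)` — the binder `hAinf`) and **`decays_limInv_sub_opLim`**
(`Decays (toMKer (limInv Λ (A k)) − toMKer (limInv Λ (opLim A))) (rateConst·(θ₀/(1−θ))·θ^k) (δ⋆/d)` — the binder `hArate`).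
NOT summit progress.
-/

namespace Summit.QuantumFields.BalabanUV.Beta.GAN24.DirichletExhaustionDecays

open Finset Real Filter Topology
open Literature.MathematicalPhysics.QuantumFieldTheory.Balaban1983to89
open Literature.MathematicalPhysics.QuantumFieldTheory.Balaban1983to89.Beta
open B12Sec2to5 (l1 l1_nonneg)
open ExpKernelCalculus (MKer Decays)
open B4Sect5Proof (cStar deltaStar cStar_pos deltaStar_pos)
open B4Sect5Exhaustion (K Hyp56Z limInv limInv_abs_le)
open Summit.QuantumFields.BalabanUV.Beta.GAN24.DirichletExhaustion

noncomputable section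

variable {d N : ℕ}

/-! ## §1 Currying and the two distances -/

/-- Currying a B4 kernel on `ℤ^d × Fin N` into a matrix-fibred kernel of the β-lane: `(toMKer C) x y a b = C (x,a) (y,b)`. -/
def toMKer (C : K d N → K d N → ℝ) : MKer d (Fin N) := fun x y a b => C (x, a) (y, b)

/-- `toMKer` is additive (differences curry to differences). -/
theorem toMKer_sub (C C' : K d N → K d N → ℝ) : toMKer C' - toMKer C = toMKer (C' - C) := by
  funext x y a b; rfl

/-- `|x − y|₁ ≤ d · dist x y` (each coordinate difference is at most the sup-distance). -/
theorem l1_sub_le_mul_dist (x y : Fin d → ℤ) : l1 (x - y) ≤ d * dist x y := by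
  unfold l1
  have h1 : ∀ i : Fin d, |((x - y) i : ℝ)| ≤ dist x y := by
    intro i
    rw [Pi.sub_apply, Int.cast_sub, ← Int.dist_eq]
    exact dist_le_pi_dist x y i
  calc ∑ i, |(((x - y) i : ℤ) : ℝ)| ≤ ∑ _i : Fin d, dist x y := Finset.sum_le_sum fun i _ => h1 i
    _ = d * dist x y := by rw [Finset.sum_const, Finset.card_univ, Fintype.card_fin, nsmul_eq_mul]

/-- An `e^{−δ·dist}` factor is at most an `e^{−(δ/d)|·|₁}` factor (`δ ≥ 0`). -/
theorem exp_sup_le_exp_l1 {δ : ℝ} (hδ : 0 ≤ δ) (x y : Fin d → ℤ) :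
    Real.exp (-(δ * dist x y)) ≤ Real.exp (-(δ / d) * l1 (x - y)) := by
  apply Real.exp_le_exp.mpr
  rcases Nat.eq_zero_or_pos d with h0 | hpos
  · subst h0
    have : dist x y = 0 := by rw [dist_eq_zero]; funext i; exact Fin.elim0 i
    simp [this]
  · have hd : (0 : ℝ) < d := by exact_mod_cast hpos
    have h := l1_sub_le_mul_dist x y
    have : δ / d * l1 (x - y) ≤ δ * dist x y := by
      calc δ / d * l1 (x - y) ≤ δ / d * (d * dist x y) :=
            mul_le_mul_of_nonneg_left h (div_nonneg hδ hd.le)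
        _ = δ * dist x y := by field_simp
    linarith

/-- **A sup-distance entry bound curries to a `Decays` bound at rate `δ/d`.** -/
theorem decays_toMKer_of_bound {C : K d N → K d N → ℝ} {c δ : ℝ} (hc : 0 ≤ c) (hδ : 0 ≤ δ)
    (h : ∀ p q : K d N, |C p q| ≤ c * Real.exp (-(δ * dist p.1 q.1))) : Decays (toMKer C) c (δ / d) := by
  intro x y a b
  exact (h (x, a) (y, b)).trans (mul_le_mul_of_nonneg_left (exp_sup_le_exp_l1 hδ x y) hc)

/-! ## §2 (CONV-C) in `Decays` currency -/

/-- The uniform clause of `ConvC` in `Decays` currency: `Decays (toMKer (C k)) C₄ (δ₄/d)` for every `k`. -/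
theorem decays_of_convC {C : ℕ → K d N → K d N → ℝ} {C₄ δ₄ θ : ℝ} (hC₄ : 0 ≤ C₄) (hδ₄ : 0 ≤ δ₄)
    (h : ConvC C C₄ δ₄ θ) (k : ℕ) : Decays (toMKer (C k)) C₄ (δ₄ / d) :=
  decays_toMKer_of_bound hC₄ hδ₄ (h.1 k)

/-- The step clause of `ConvC` in `Decays` currency: `Decays (toMKer (C (k+1)) − toMKer (C k)) (C₄θ^k) (δ₄/d)` — LITERALLY the
shape `Decays (A j − A′) εA δ` of `HessKerRate.decay510_hessKer_sub` / `geometricRate_hessKer` with `εA = C₄θ^k`. -/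
theorem decays_sub_of_convC {C : ℕ → K d N → K d N → ℝ} {C₄ δ₄ θ : ℝ} (hC₄ : 0 ≤ C₄) (hδ₄ : 0 ≤ δ₄) (hθ : 0 ≤ θ)
    (h : ConvC C C₄ δ₄ θ) (k : ℕ) : Decays (toMKer (C (k + 1)) - toMKer (C k)) (C₄ * θ ^ k) (δ₄ / d) := by
  rw [toMKer_sub]
  exact decays_toMKer_of_bound (by positivity) hδ₄ (fun p q => h.2 k p q)

/-! ## §3 The Dirichlet inverse families of PART 1 in `Decays` currency -/

section Family

variable {Ω : Set (Fin d → ℤ)} {A : ℕ → K d N → K d N → ℝ} {γ₀ c₀ δ₀ θ₀ θ : ℝ}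

/-- **Uniform decay of the Dirichlet inverse family in `Decays` currency**: `Decays (toMKer (limInv Λ (A k))) c⋆ (δ⋆/d)`. -/
theorem decays_limInv (hγ : 0 < γ₀) (hc : 0 < c₀) (hδ : 0 < δ₀) (hF : OpFamilyRate Ω A γ₀ c₀ δ₀ θ₀ θ)
    {Λ : Set (Fin d → ℤ)} (hΛ : Λ ⊆ Ω) (k : ℕ) :
    Decays (toMKer (limInv Λ (A k))) (cStar d N γ₀ c₀ δ₀) (deltaStar d N γ₀ c₀ δ₀ / d) :=
  decays_toMKer_of_bound (cStar_pos d N c₀ δ₀ hγ).le (deltaStar_pos d N hγ hc.le hδ).le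
    fun p q => limInv_abs_le hγ hc hδ ((hF.hyp56 k).mono hΛ) p q

/-- **The one-step rate of the Dirichlet inverse family in `Decays` currency**:
`Decays (toMKer (limInv Λ (A (k+1))) − toMKer (limInv Λ (A k))) (rateConst·θ₀·θ^k) (δ⋆/d)` for every `Λ ⊆ Ω` — the (CONV-C)
input of the β-lane's `HessKerRate` §4 for a constituent that is a Dirichlet inverse of a unit-lattice operator family. -/
theorem decays_limInv_sub (hγ : 0 < γ₀) (hc : 0 < c₀) (hδ : 0 < δ₀) (hθ₀ : 0 ≤ θ₀) (hθ : 0 ≤ θ)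
    (hF : OpFamilyRate Ω A γ₀ c₀ δ₀ θ₀ θ) {Λ : Set (Fin d → ℤ)} (hΛ : Λ ⊆ Ω) (k : ℕ) :
    Decays (toMKer (limInv Λ (A (k + 1))) - toMKer (limInv Λ (A k)))
      (rateConst d N γ₀ c₀ δ₀ * θ₀ * θ ^ k) (deltaStar d N γ₀ c₀ δ₀ / d) := by
  rw [toMKer_sub]
  have hR := rateConst_nonneg d N hγ hc.le hδ
  refine decays_toMKer_of_bound (by positivity) (deltaStar_pos d N hγ hc.le hδ).le fun p q => ?_
  rw [Pi.sub_apply, Pi.sub_apply, abs_sub_comm, mul_assoc (rateConst d N γ₀ c₀ δ₀)]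
  exact limInv_sub_limInv_rate hγ hc hδ (by positivity) (hF.hyp56 k) (hF.hyp56 (k + 1)) (hF.step k) hΛ p q

end Family

/-! ## §4 (v1.1) The LIMIT clauses: distance to the Dirichlet inverse of the limit operator `opLim A`

`HessKerRate.geometricRate_hessKer` / `geomRate_secondMoment_hessKer` take, for the propagator ingredient, the triple
`hA : ∀ j, Decays (A j) C δ`, `hAinf : Decays A∞ C δ`, `hArate : ∀ j, Decays (A j − A∞) (c_A θ^j) δ` — the distance to a LIMIT
kernel, not the consecutive-level step of §3.  For a Dirichlet inverse family the limit kernel is `limInv Λ (opLim A)` (PART 2: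
`opLim A` = the entrywise limit of the operator family, which inherits (5.6) — `hyp56Z_opLim` — and whose Dirichlet inverse is the
entrywise limit of the inverses, `dirichletExhaustion_limit`), and PART 2's `dirichletExhaustion_rate` is exactly `hArate` in B4's
sup-distance currency with `c_A = rateConst·θ₀/(1−θ)`.  The two theorems below curry it: with §3's `decays_limInv` (= `hA`) the
triple is complete, same `C = c⋆`, same `δ = δ⋆/d`, for every `Λ ⊆ Ω`. -/

section Limit

open Summit.QuantumFields.BalabanUV.Beta.GAN24.DirichletExhaustionFamily (opLim dirichletExhaustion_rate limInv_opLim_abs_le)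

variable {Ω : Set (Fin d → ℤ)} {A : ℕ → K d N → K d N → ℝ} {γ₀ c₀ δ₀ θ₀ θ : ℝ}

/-- **`hAinf`** — uniform decay of the Dirichlet inverse of the LIMIT operator, same constants as the family:
`Decays (toMKer (limInv Λ (opLim A))) c⋆ (δ⋆/d)` (PART 2 `limInv_opLim_abs_le`, curried). -/
theorem decays_limInv_opLim (hγ : 0 < γ₀) (hc : 0 < c₀) (hδ : 0 < δ₀) (hθ1 : θ < 1)
    (hF : OpFamilyRate Ω A γ₀ c₀ δ₀ θ₀ θ) {Λ : Set (Fin d → ℤ)} (hΛ : Λ ⊆ Ω) :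
    Decays (toMKer (limInv Λ (opLim A))) (cStar d N γ₀ c₀ δ₀) (deltaStar d N γ₀ c₀ δ₀ / d) :=
  decays_toMKer_of_bound (cStar_pos d N c₀ δ₀ hγ).le (deltaStar_pos d N hγ hc.le hδ).le
    fun p q => limInv_opLim_abs_le hγ hc hδ hθ1 hF hΛ p q

/-- **`hArate`** — GEOMETRIC DISTANCE TO THE LIMIT in `Decays` currency:
`Decays (toMKer (limInv Λ (A k)) − toMKer (limInv Λ (opLim A))) (rateConst·(θ₀/(1−θ))·θ^k) (δ⋆/d)` for every `Λ ⊆ Ω` and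
every `k` (PART 2 `dirichletExhaustion_rate`, curried) — literally the binder `hArate : ∀ j, Decays (A j − A∞) (c_A θ^j) δ` of
`HessKerRate.geometricRate_hessKer` with `A j := toMKer (limInv Λ (A j))`, `A∞ := toMKer (limInv Λ (opLim A))`,
`c_A := rateConst·θ₀/(1−θ)`, `δ := δ⋆/d`. -/
theorem decays_limInv_sub_opLim (hγ : 0 < γ₀) (hc : 0 < c₀) (hδ : 0 < δ₀) (hθ₀ : 0 ≤ θ₀) (hθ : 0 ≤ θ)
    (hθ1 : θ < 1) (hF : OpFamilyRate Ω A γ₀ c₀ δ₀ θ₀ θ) {Λ : Set (Fin d → ℤ)} (hΛ : Λ ⊆ Ω) (k : ℕ) :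
    Decays (toMKer (limInv Λ (A k)) - toMKer (limInv Λ (opLim A)))
      (rateConst d N γ₀ c₀ δ₀ * (θ₀ / (1 - θ)) * θ ^ k) (deltaStar d N γ₀ c₀ δ₀ / d) := by
  rw [toMKer_sub]
  have hR := rateConst_nonneg d N hγ hc.le hδ
  have h1 : 0 < 1 - θ := by linarith
  refine decays_toMKer_of_bound (by positivity) (deltaStar_pos d N hγ hc.le hδ).le fun p q => ?_
  rw [Pi.sub_apply, Pi.sub_apply, abs_sub_comm, mul_assoc (rateConst d N γ₀ c₀ δ₀)]
  exact dirichletExhaustion_rate hγ hc hδ hθ₀ hθ hθ1 hF hΛ k p q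

/-- The complete propagator-ingredient triple `(hA, hAinf, hArate)` of `HessKerRate.geometricRate_hessKer` for a Dirichlet inverse
family, packaged as one conjunction (constants `c⋆`, `rateConst·θ₀/(1−θ)`, rate `δ⋆/d`, ratio `θ`). -/
theorem decays_limInv_triple (hγ : 0 < γ₀) (hc : 0 < c₀) (hδ : 0 < δ₀) (hθ₀ : 0 ≤ θ₀) (hθ : 0 ≤ θ)
    (hθ1 : θ < 1) (hF : OpFamilyRate Ω A γ₀ c₀ δ₀ θ₀ θ) {Λ : Set (Fin d → ℤ)} (hΛ : Λ ⊆ Ω) :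
    (∀ k, Decays (toMKer (limInv Λ (A k))) (cStar d N γ₀ c₀ δ₀) (deltaStar d N γ₀ c₀ δ₀ / d)) ∧
      Decays (toMKer (limInv Λ (opLim A))) (cStar d N γ₀ c₀ δ₀) (deltaStar d N γ₀ c₀ δ₀ / d) ∧
      (∀ k, Decays (toMKer (limInv Λ (A k)) - toMKer (limInv Λ (opLim A)))
        (rateConst d N γ₀ c₀ δ₀ * (θ₀ / (1 - θ)) * θ ^ k) (deltaStar d N γ₀ c₀ δ₀ / d)) :=
  ⟨fun k => decays_limInv hγ hc hδ hF hΛ k, decays_limInv_opLim hγ hc hδ hθ1 hF hΛ,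
    fun k => decays_limInv_sub_opLim hγ hc hδ hθ₀ hθ hθ1 hF hΛ k⟩

end Limit

end

end Summit.QuantumFields.BalabanUV.Beta.GAN24.DirichletExhaustionDecays
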